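import Literature.MathematicalPhysics.QuantumFieldTheory.Chatterjee2026YMHiggs.DiscreteProcaField
import Literature.MathematicalPhysics.QuantumFieldTheory.GaussianToolkit
import HarnessLib

/-!
# Chatterjee 2026, Lemma 4.10 (covariance decay of the discrete Proca field) — discharge of
# `discreteProca_covariance_decay`

S. Chatterjee, *A scaling limit of `SU(2)` lattice Yang–Mills–Higgs theory*, Probab. Math. Phys. 7
(2026) 339–381, arXiv:2401.10507 [Chatterjee2026YMHiggs], §4.6, Lemma 4.10: for the discrete Proca
field `X` on `Λ_L = {−L, …, L}ᵈ` with mass parameter `0 < ε ≤ 1`,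
`|E(X(e) X(e'))| ≤ ε⁻² (1 − ε²/(16 d))^{d(e,e')}`, `d(e, e')` the graph distance in the graph on edges
in which two edges are neighbours iff they share a plaquette.

Sibling proof file of `DiscreteProcaField.lean` (statements): the named fact
`Literature.MathematicalPhysics.QuantumFieldTheory.Chatterjee2026YMHiggs.discreteProca_covariance_decay`
is proved as `discreteProca_covariance_decay_holds`.  The file introduces proof-plumbing definitions
(the incidence vectors `curlVec`, the precision matrix `precMat`, the iteration matrix `iterMat`) and
no named fact.

## The printed proof (§4.6) and the proof here

Printed: the density of `X` is `∝ exp(−½ xᵀ Q x)` with `Q = Σ_p λ_p λ_pᵀ + ε² I` (`λ_p` the signed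
incidence vector of the plaquette `p`), so `Cov(X) = R = Q⁻¹`; writing `Q = M (I − S)` with `M` an
upper bound of `Q` (`M = 16 d ε^{d−2}` at lattice spacing `ε`; here, at unit spacing with the mass
term `ε² Σ x(e)²` of Definition 4.5, `M = 16 d`), one has `0 ≤ S ≤ 1 − ε²/M`, the Neumann series
`R = M⁻¹ Σ_k Sᵏ`, and `Sᵏ(e, e') = 0` for `k < d(e, e')` since `S(e, e') ≠ 0` only for equal or
neighbouring edges; summing the tail of the geometric series gives the bound.  Here:

* §1 (generic linear algebra on `ℝ^ι`): for a symmetric `S` with `0 ≤ vᵀSv ≤ θ‖v‖²`, Cauchy–Schwarz for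
  the form (`GaussianToolkit.dotProduct_mulVec_sq_le`) gives `‖Sv‖ ≤ θ‖v‖`, hence
  `|uᵀ Sᵏ v| ≤ θᵏ ‖u‖ ‖v‖` (no spectral theorem needed); the FINITE Neumann identity
  `Q⁻¹ = Sᵏ Q⁻¹ + M⁻¹ Σ_{j<k} Sʲ` (telescoping, in place of the infinite series); and the support
  propagation `Sʲ(e, e') ≠ 0 ⇒ d(e, e') ≤ j`.
* §2 the precision matrix `precMat = Σ_p λ_p λ_pᵀ + ε²·1` on `ℝ^{E}`, `E = procaEdges d L`, with
  `vᵀ Q v = 2·procaEnergy(v)` and the form bounds `ε²‖v‖² ≤ vᵀQv ≤ (16(d−1) + ε²)‖v‖²` (each of the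
  four edge slots of a plaquette is hit by at most `d − 1` plaquettes of `Λ_L`).
* §3 `iterMat = 1 − (16d)⁻¹ Q`: `0 ≤ vᵀSv ≤ (1 − ε²/(16d))‖v‖²`, and its support lies in the
  plaquette-neighbour graph `procaEdgeGraph`.
* §4 the Gaussian identification: `discreteProcaMeasure d L ε` is the image of Mathlib's
  `multivariateGaussian 0 Q⁻¹` (through `GaussianToolkit.multivariateGaussian_inv_eq_withDensity` and the
  volume-preserving identification `EuclideanSpace ℝ E ≃ (E → ℝ)`), so `E(X(e)X(e')) = Q⁻¹(e, e')`
  (`ProbabilityTheory.covariance_eval_multivariateGaussian`, centredness).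
* §5 assembly: `Q⁻¹(e,e') = (Sᵏ Q⁻¹)(e,e')` for `k ≤ d(e,e')`, `|(SᵏQ⁻¹)(e,e')| ≤ θᵏ ‖Q⁻¹ δ_{e'}‖ ≤ θᵏ ε⁻²`
  (`GaussianToolkit.norm_inv_mulVec_le`).

## References

* S. Chatterjee, arXiv:2401.10507v4, §4.3 (Definition 4.5), §4.6 (Lemma 4.10 and its proof)
  [Chatterjee2026YMHiggs].
-/

noncomputable section

open MeasureTheory ProbabilityTheory Finset Matrix WithLp
open scoped ENNReal
open Literature.MathematicalPhysics.QuantumLattice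
open Literature.Probability.LatticeModels (box mem_box)

namespace Literature.MathematicalPhysics.QuantumFieldTheory.Chatterjee2026YMHiggs

namespace CovarianceDecayProof

open GaussianToolkit

/-! ## §1 Generic linear algebra on `ℝ^ι` -/

section LinAlg

variable {ι : Type*} [Fintype ι] [DecidableEq ι]

omit [DecidableEq ι] in
/-- `v·v ≥ 0`. [folklore] -/
private theorem dotProduct_self_nonneg' (v : ι → ℝ) : 0 ≤ v ⬝ᵥ v :=
  Finset.sum_nonneg fun i _ => mul_self_nonneg (v i)

omit [DecidableEq ι] in
/-- **Cauchy–Schwarz** for the dot product: `(u·w)² ≤ (u·u)(w·w)`. [folklore] -/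
private theorem dotProduct_sq_le (u w : ι → ℝ) : (u ⬝ᵥ w) ^ 2 ≤ (u ⬝ᵥ u) * (w ⬝ᵥ w) := by
  classical
  have h := dotProduct_mulVec_sq_le (P := (1 : Matrix ι ι ℝ)) Matrix.transpose_one
    (fun v => by rw [Matrix.one_mulVec]; exact dotProduct_self_nonneg' v) u w
  simpa only [Matrix.one_mulVec] using h

omit [DecidableEq ι] in
/-- **A symmetric form with `0 ≤ vᵀSv ≤ θ‖v‖²` is a `θ`-contraction**: `‖Sv‖² ≤ θ²‖v‖²`.  From
Cauchy–Schwarz for the positive semidefinite form `S`: `‖Sv‖⁴ = ((Sv)ᵀ S v)² ≤ ((Sv)ᵀS(Sv))(vᵀSv)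
≤ θ² ‖Sv‖² ‖v‖²`. [folklore] -/
private theorem mulVec_dotProduct_self_le {S : Matrix ι ι ℝ} (hSt : Sᵀ = S) (h0 : ∀ v, 0 ≤ v ⬝ᵥ S *ᵥ v)
    {θ : ℝ} (hθ : 0 ≤ θ) (hup : ∀ v, v ⬝ᵥ S *ᵥ v ≤ θ * (v ⬝ᵥ v)) (v : ι → ℝ) :
    (S *ᵥ v) ⬝ᵥ (S *ᵥ v) ≤ θ ^ 2 * (v ⬝ᵥ v) := by
  set w := S *ᵥ v with hw
  have hcs := dotProduct_mulVec_sq_le hSt h0 w v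
  rw [← hw] at hcs
  have hww : 0 ≤ w ⬝ᵥ w := dotProduct_self_nonneg' w
  have hvv : 0 ≤ v ⬝ᵥ v := dotProduct_self_nonneg' v
  have h1 : w ⬝ᵥ S *ᵥ w ≤ θ * (w ⬝ᵥ w) := hup w
  have h2 : v ⬝ᵥ S *ᵥ v ≤ θ * (v ⬝ᵥ v) := hup v
  have h3 : (w ⬝ᵥ w) ^ 2 ≤ θ * (w ⬝ᵥ w) * (θ * (v ⬝ᵥ v)) :=
    hcs.trans (mul_le_mul h1 h2 (h0 v) (mul_nonneg hθ hww))
  rcases eq_or_lt_of_le hww with h | h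
  · rw [← h]; positivity
  · nlinarith

omit [DecidableEq ι] in
/-- Powers of a `θ`-contraction: `‖Sᵏ v‖² ≤ θ^{2k} ‖v‖²`. [folklore] -/
private theorem pow_mulVec_dotProduct_self_le [DecidableEq ι] {S : Matrix ι ι ℝ} (hSt : Sᵀ = S)
    (h0 : ∀ v, 0 ≤ v ⬝ᵥ S *ᵥ v) {θ : ℝ} (hθ : 0 ≤ θ) (hup : ∀ v, v ⬝ᵥ S *ᵥ v ≤ θ * (v ⬝ᵥ v))
    (k : ℕ) (v : ι → ℝ) :
    (S ^ k *ᵥ v) ⬝ᵥ (S ^ k *ᵥ v) ≤ θ ^ (2 * k) * (v ⬝ᵥ v) := by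
  induction k generalizing v with
  | zero => simp
  | succ k ih =>
    rw [pow_succ, ← Matrix.mulVec_mulVec]
    refine (ih (S *ᵥ v)).trans ?_
    have h := mulVec_dotProduct_self_le hSt h0 hθ hup v
    calc θ ^ (2 * k) * ((S *ᵥ v) ⬝ᵥ (S *ᵥ v)) ≤ θ ^ (2 * k) * (θ ^ 2 * (v ⬝ᵥ v)) :=
          mul_le_mul_of_nonneg_left h (pow_nonneg hθ _)
      _ = θ ^ (2 * (k + 1)) * (v ⬝ᵥ v) := by ring

/-- **Matrix elements of powers of a contraction**: `|uᵀ Sᵏ v| ≤ θᵏ ‖u‖ ‖v‖`, in the squared form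
`(uᵀ Sᵏ v)² ≤ θ^{2k} (u·u)(v·v)`. [folklore] -/
private theorem dotProduct_pow_mulVec_sq_le {S : Matrix ι ι ℝ} (hSt : Sᵀ = S)
    (h0 : ∀ v, 0 ≤ v ⬝ᵥ S *ᵥ v) {θ : ℝ} (hθ : 0 ≤ θ) (hup : ∀ v, v ⬝ᵥ S *ᵥ v ≤ θ * (v ⬝ᵥ v))
    (k : ℕ) (u v : ι → ℝ) :
    (u ⬝ᵥ (S ^ k *ᵥ v)) ^ 2 ≤ θ ^ (2 * k) * (u ⬝ᵥ u) * (v ⬝ᵥ v) := by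
  have h1 := dotProduct_sq_le u (S ^ k *ᵥ v)
  have h2 := pow_mulVec_dotProduct_self_le hSt h0 hθ hup k v
  calc (u ⬝ᵥ (S ^ k *ᵥ v)) ^ 2 ≤ (u ⬝ᵥ u) * ((S ^ k *ᵥ v) ⬝ᵥ (S ^ k *ᵥ v)) := h1
    _ ≤ (u ⬝ᵥ u) * (θ ^ (2 * k) * (v ⬝ᵥ v)) :=
        mul_le_mul_of_nonneg_left h2 (dotProduct_self_nonneg' u)
    _ = θ ^ (2 * k) * (u ⬝ᵥ u) * (v ⬝ᵥ v) := by ring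

/-- **The finite Neumann identity** (telescoping): if `Q` is invertible and `S = 1 − M⁻¹ Q`, then for
every `k`, `Q⁻¹ = Sᵏ Q⁻¹ + M⁻¹ Σ_{j<k} Sʲ` (the printed `R = M⁻¹ Σ_k Sᵏ`, truncated with remainder).
[cite: Chatterjee2026YMHiggs, Lemma 4.10 (proof, Neumann series R = (16dε^{d-2})⁻¹ Σ Sᵏ)] -/
theorem inv_eq_pow_mul_inv_add_sum {Q : Matrix ι ι ℝ} (hQ : IsUnit Q.det) (M : ℝ) (k : ℕ) :
    Q⁻¹ = (1 - M⁻¹ • Q) ^ k * Q⁻¹ + M⁻¹ • ∑ j ∈ Finset.range k, (1 - M⁻¹ • Q) ^ j := by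
  have hstep : Q⁻¹ = (1 - M⁻¹ • Q) * Q⁻¹ + M⁻¹ • (1 : Matrix ι ι ℝ) := by
    rw [Matrix.sub_mul, Matrix.one_mul, Matrix.smul_mul, Matrix.mul_nonsing_inv Q hQ]
    abel
  induction k with
  | zero => simp
  | succ k ih =>
    have h2 : (1 - M⁻¹ • Q) ^ k * Q⁻¹ = (1 - M⁻¹ • Q) ^ (k + 1) * Q⁻¹ + M⁻¹ • (1 - M⁻¹ • Q) ^ k := by
      conv_lhs => rw [hstep]
      rw [Matrix.mul_add, ← Matrix.mul_assoc, ← pow_succ, Matrix.mul_smul, Matrix.mul_one]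
    calc Q⁻¹ = (1 - M⁻¹ • Q) ^ k * Q⁻¹ + M⁻¹ • ∑ j ∈ Finset.range k, (1 - M⁻¹ • Q) ^ j := ih
      _ = (1 - M⁻¹ • Q) ^ (k + 1) * Q⁻¹ + M⁻¹ • (1 - M⁻¹ • Q) ^ k +
            M⁻¹ • ∑ j ∈ Finset.range k, (1 - M⁻¹ • Q) ^ j := by rw [h2]
      _ = (1 - M⁻¹ • Q) ^ (k + 1) * Q⁻¹ + M⁻¹ • ∑ j ∈ Finset.range (k + 1), (1 - M⁻¹ • Q) ^ j := by
          rw [Finset.sum_range_succ, smul_add]; abel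

omit [DecidableEq ι] in
/-- **Support propagation**: if the entries `S(i, j)` vanish unless the vertices `φ i`, `φ j` of a graph
`G` are equal or adjacent, then `Sᵏ(i, j) ≠ 0` forces `d_G(φ i, φ j) ≤ k` (the printed
"`Sᵏ(e, e') = 0` for `k < d(e, e')`"). [cite: Chatterjee2026YMHiggs, Lemma 4.10 (proof, sparsity of Sᵏ)] -/
theorem edist_le_of_pow_apply_ne_zero [DecidableEq ι] {V : Type*} (G : SimpleGraph V) (φ : ι → V)
    {S : Matrix ι ι ℝ} (hS : ∀ i j, S i j ≠ 0 → φ i = φ j ∨ G.Adj (φ i) (φ j)) :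
    ∀ (k : ℕ) (i j : ι), (S ^ k) i j ≠ 0 → G.edist (φ i) (φ j) ≤ k := by
  intro k
  induction k with
  | zero =>
    intro i j h
    rw [pow_zero] at h
    have hij : i = j := by
      by_contra hne
      exact h (Matrix.one_apply_ne hne)
    subst hij
    simp
  | succ k ih =>
    intro i j h
    rw [pow_succ, Matrix.mul_apply] at h
    obtain ⟨l, -, hl⟩ := Finset.exists_ne_zero_of_sum_ne_zero h
    have h1 : (S ^ k) i l ≠ 0 := fun h0 => hl (by rw [h0, zero_mul])
    have h2 : S l j ≠ 0 := fun h0 => hl (by rw [h0, mul_zero])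
    have h3 : G.edist (φ l) (φ j) ≤ 1 := by
      rcases hS l j h2 with h | h
      · rw [h, SimpleGraph.edist_self]; exact bot_le
      · exact (SimpleGraph.edist_eq_one_iff_adj.mpr h).le
    calc G.edist (φ i) (φ j) ≤ G.edist (φ i) (φ l) + G.edist (φ l) (φ j) := SimpleGraph.edist_triangle
      _ ≤ (k : ℕ∞) + 1 := add_le_add (ih i l h1) h3
      _ = ((k + 1 : ℕ) : ℕ∞) := by push_cast; rfl

end LinAlg

/-! ## §2 The precision matrix of the discrete Proca field and its form bounds -/

section Precision

variable {d : ℕ}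

variable (d) in
/-- The signed incidence vector `λ_p ∈ ℝ^{E}` of the plaquette `p = (x; i < j)` on the edges
`E = procaEdges d L` of `Λ_L`: `+1` on `(x, i)` and `(x + eᵢ, j)`, `−1` on `(x + eⱼ, i)` and `(x, j)`
(so that `λ_p · y = y(p)`, the oriented plaquette sum of Definition 4.5, `curlVec_dotProduct`).
[cite: Chatterjee2026YMHiggs, §4.3 (the display defining x(p)) and Lemma 4.10 (proof, Q = Σ λ_p λ_pᵀ + ε²I)] -/
def curlVec (L : ℕ) (p : ZdPlaquette d) : procaEdges d L → ℝ := fun f =>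
  (if f.1 = (p.1, p.2.1.1) then 1 else 0) + (if f.1 = (p.1 + Pi.single p.2.1.1 1, p.2.1.2) then 1 else 0) -
    (if f.1 = (p.1 + Pi.single p.2.1.2 1, p.2.1.1) then 1 else 0) - (if f.1 = (p.1, p.2.1.2) then 1 else 0)

/-- Summing `y` against the indicator of an edge of `ℤᵈ` over the edges of `Λ_L` gives the extension by
zero of `y`. [folklore] -/
private theorem sum_ite_eq_extendEdges {L : ℕ} (y : procaEdges d L → ℝ) (e : ZdEdge d) :
    ∑ f : procaEdges d L, (if f.1 = e then 1 else 0) * y f = extendEdges d L y e := by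
  classical
  unfold extendEdges
  by_cases he : e ∈ procaEdges d L
  · rw [dif_pos he, Finset.sum_eq_single ⟨e, he⟩]
    · simp
    · intro f _ hf
      have : f.1 ≠ e := fun h => hf (Subtype.ext h)
      simp [this]
    · intro h; exact absurd (Finset.mem_univ _) h
  · rw [dif_neg he]
    refine Finset.sum_eq_zero fun f _ => ?_
    have : f.1 ≠ e := fun h => he (h ▸ f.2)
    simp [this]

/-- `λ_p · y = y(p)`: the incidence vector reproduces the oriented plaquette sum of the extension by zero.
[cite: Chatterjee2026YMHiggs, §4.3 (the display defining x(p))] -/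
theorem curlVec_dotProduct {L : ℕ} (p : ZdPlaquette d) (y : procaEdges d L → ℝ) :
    curlVec d L p ⬝ᵥ y = latticeCurl (extendEdges d L y) p := by
  simp only [dotProduct, curlVec, add_mul, sub_mul, Finset.sum_add_distrib, Finset.sum_sub_distrib,
    sum_ite_eq_extendEdges, latticeCurl]

variable (d) in
/-- **The precision matrix** `Q = Σ_{p ∈ P} λ_p λ_pᵀ + ε² I` of the discrete Proca density
`∝ exp(−½ xᵀQx)` (Definition 4.5 / proof of Lemma 4.10), on `ℝ^{E}`, `E = procaEdges d L`.
[cite: Chatterjee2026YMHiggs, Lemma 4.10 (proof: "the probability density of X is proportional to exp(−½xᵀQx)")] -/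
def precMat (L : ℕ) (ε : ℝ) : Matrix (procaEdges d L) (procaEdges d L) ℝ :=
  ∑ p ∈ procaPlaquettes d L, vecMulVec (curlVec d L p) (curlVec d L p) +
    ε ^ 2 • (1 : Matrix (procaEdges d L) (procaEdges d L) ℝ)

/-- `Q` is symmetric. [folklore] -/
private theorem precMat_transpose (L : ℕ) (ε : ℝ) : (precMat d L ε)ᵀ = precMat d L ε := by
  classical
  rw [precMat, Matrix.transpose_add, Matrix.transpose_sum, Matrix.transpose_smul, Matrix.transpose_one]
  congr 1
  exact Finset.sum_congr rfl fun p _ => by rw [Matrix.transpose_vecMulVec]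

/-- The quadratic form of `Q`: `vᵀ Q v = Σ_p (λ_p · v)² + ε² ‖v‖²`. [cite: Chatterjee2026YMHiggs, Lemma 4.10 (proof)] -/
theorem dotProduct_precMat_mulVec {L : ℕ} (ε : ℝ) (v : procaEdges d L → ℝ) :
    v ⬝ᵥ precMat d L ε *ᵥ v = ∑ p ∈ procaPlaquettes d L, (curlVec d L p ⬝ᵥ v) ^ 2 + ε ^ 2 * (v ⬝ᵥ v) := by
  classical
  rw [precMat, Matrix.add_mulVec, dotProduct_add, Matrix.sum_mulVec, dotProduct_sum, Matrix.smul_mulVec,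
    Matrix.one_mulVec, dotProduct_smul, smul_eq_mul]
  congr 1
  refine Finset.sum_congr rfl fun p _ => ?_
  have h1 : vecMulVec (curlVec d L p) (curlVec d L p) *ᵥ v = (curlVec d L p ⬝ᵥ v) • curlVec d L p := by
    ext i
    simp only [Matrix.mulVec, vecMulVec_apply, dotProduct, Pi.smul_apply, smul_eq_mul, Finset.sum_mul]
    exact Finset.sum_congr rfl fun j _ => by ring
  rw [h1, dotProduct_smul, smul_eq_mul, dotProduct_comm, sq]

/-- `vᵀ Q v = 2 H(v)`: the precision form is twice the Proca energy of the extension by zero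
(`‖v‖² = Σ_{e ∈ E} v(e)²`). [cite: Chatterjee2026YMHiggs, Def. 4.5 and Lemma 4.10 (proof)] -/
theorem dotProduct_precMat_mulVec_eq_procaEnergy {L : ℕ} (ε : ℝ) (v : procaEdges d L → ℝ) :
    v ⬝ᵥ precMat d L ε *ᵥ v = 2 * procaEnergy d L ε (extendEdges d L v) := by
  classical
  rw [dotProduct_precMat_mulVec, procaEnergy]
  have h1 : ∑ e ∈ procaEdges d L, extendEdges d L v e ^ 2 = v ⬝ᵥ v := by
    rw [← Finset.sum_coe_sort (procaEdges d L), dotProduct]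
    refine Finset.sum_congr rfl fun f _ => ?_
    rw [extendEdges, dif_pos f.2, sq]
  simp only [curlVec_dotProduct, h1]
  ring

/-- Lower form bound: `ε² ‖v‖² ≤ vᵀ Q v`. [cite: Chatterjee2026YMHiggs, Lemma 4.10 (proof: "Q ≥ ε² I")] -/
theorem le_dotProduct_precMat_mulVec {L : ℕ} (ε : ℝ) (v : procaEdges d L → ℝ) :
    ε ^ 2 * (v ⬝ᵥ v) ≤ v ⬝ᵥ precMat d L ε *ᵥ v := by
  rw [dotProduct_precMat_mulVec]
  have : 0 ≤ ∑ p ∈ procaPlaquettes d L, (curlVec d L p ⬝ᵥ v) ^ 2 := Finset.sum_nonneg fun _ _ => sq_nonneg _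
  linarith

/-- `Q` is positive definite for `ε ≠ 0`. [cite: Chatterjee2026YMHiggs, Lemma 4.10 (proof) and Thm 4.6 (proof, "xᵀQx ≥ εᵈ‖x‖²")] -/
theorem posDef_precMat (L : ℕ) {ε : ℝ} (hε : ε ≠ 0) : (precMat d L ε).PosDef := by
  classical
  refine Matrix.PosDef.of_dotProduct_mulVec_pos ?_ fun v hv => ?_
  · rw [Matrix.IsHermitian, Matrix.conjTranspose_eq_transpose_of_trivial, precMat_transpose]
  · simp only [star_trivial]
    have h := le_dotProduct_precMat_mulVec ε v
    have hvv : 0 < v ⬝ᵥ v := by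
      rcases eq_or_lt_of_le (dotProduct_self_nonneg' v) with h0 | h0
      · exact absurd (dotProduct_self_eq_zero.mp h0.symm) hv
      · exact h0
    exact lt_of_lt_of_le (by positivity) h

/-! ### The upper form bound `vᵀ Q v ≤ (16(d−1) + ε²)‖v‖²` -/

/-- `(a + b − c − e)² ≤ 4(a² + b² + c² + e²)`. [folklore] -/
private theorem sq_add_sub_sub_le (a b c e : ℝ) :
    (a + b - c - e) ^ 2 ≤ 4 * (a ^ 2 + b ^ 2 + c ^ 2 + e ^ 2) := by
  nlinarith [sq_nonneg (a - b), sq_nonneg (a + c), sq_nonneg (a + e), sq_nonneg (b + c), sq_nonneg (b + e),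
    sq_nonneg (c - e)]

/-- A sum over plaquettes of a non-negative edge function vanishing off `E`, evaluated at an edge slot
`s(p)` whose fibres in `P` have at most `d − 1` elements, is at most `(d − 1)` times its sum over `E`.
[folklore] -/
private theorem sum_slot_le {L : ℕ} (s : ZdPlaquette d → ZdEdge d)
    (hs : ∀ e : ZdEdge d, #((procaPlaquettes d L).filter fun p => s p = e) ≤ d - 1)
    (g : ZdEdge d → ℝ) (hg : ∀ e, 0 ≤ g e) (hg0 : ∀ e, e ∉ procaEdges d L → g e = 0) :
    ∑ p ∈ procaPlaquettes d L, g (s p) ≤ (d - 1 : ℕ) * ∑ e ∈ procaEdges d L, g e := by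
  classical
  rw [Finset.sum_comp]
  calc ∑ e ∈ (procaPlaquettes d L).image s, #((procaPlaquettes d L).filter fun p => s p = e) • g e
      ≤ ∑ e ∈ (procaPlaquettes d L).image s, ((d - 1 : ℕ) : ℝ) * g e := by
        refine Finset.sum_le_sum fun e _ => ?_
        rw [nsmul_eq_mul]
        exact mul_le_mul_of_nonneg_right (by exact_mod_cast hs e) (hg e)
    _ = (d - 1 : ℕ) * ∑ e ∈ (procaPlaquettes d L).image s, g e := by rw [Finset.mul_sum]
    _ ≤ (d - 1 : ℕ) * ∑ e ∈ procaEdges d L, g e := by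
        refine mul_le_mul_of_nonneg_left ?_ (Nat.cast_nonneg _)
        rw [← Finset.sum_filter_add_sum_filter_not ((procaPlaquettes d L).image s) (· ∈ procaEdges d L)]
        have h0 : ∑ e ∈ ((procaPlaquettes d L).image s).filter (fun e => ¬ e ∈ procaEdges d L), g e = 0 :=
          Finset.sum_eq_zero fun e he => hg0 e (Finset.mem_filter.1 he).2
        rw [h0, add_zero]
        exact Finset.sum_le_sum_of_subset_of_nonneg (fun e he => (Finset.mem_filter.1 he).2)
          fun e _ _ => hg e

/-- Fibres of the slot `p ↦ (x, i)`: at most `d − 1` plaquettes of `Λ_L`. [folklore] -/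
private theorem card_slot1_le {L : ℕ} (e : ZdEdge d) :
    #((procaPlaquettes d L).filter fun p : ZdPlaquette d => ((p.1, p.2.1.1) : ZdEdge d) = e) ≤ d - 1 := by
  classical
  have h := Finset.card_le_card_of_injOn (s := (procaPlaquettes d L).filter fun p : ZdPlaquette d =>
      ((p.1, p.2.1.1) : ZdEdge d) = e) (t := (Finset.univ : Finset (Fin d)).erase e.2)
    (f := fun p => p.2.1.2) (fun p hp => ?_) (fun p hp p' hp' hpp => ?_)
  · simpa [Finset.card_erase_of_mem (Finset.mem_univ _), Finset.card_univ, Fintype.card_fin] using h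
  · obtain ⟨-, hp⟩ := Finset.mem_filter.1 (Finset.mem_coe.1 hp)
    have hi : p.2.1.1 = e.2 := (Prod.mk.inj hp).2
    rw [Finset.mem_coe, Finset.mem_erase]
    exact ⟨fun hj => absurd p.2.2 (by
      have hj' : p.2.1.2 = e.2 := hj
      rw [hi, hj']; exact lt_irrefl _), Finset.mem_univ _⟩
  · obtain ⟨-, hp1⟩ := Finset.mem_filter.1 (Finset.mem_coe.1 hp)
    obtain ⟨-, hp1'⟩ := Finset.mem_filter.1 (Finset.mem_coe.1 hp')
    obtain ⟨hx, hi⟩ := Prod.mk.inj hp1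
    obtain ⟨hx', hi'⟩ := Prod.mk.inj hp1'
    exact Prod.ext (hx.trans hx'.symm) (Subtype.ext (Prod.ext (hi.trans hi'.symm) hpp))

/-- Fibres of the slot `p ↦ (x + eᵢ, j)`: at most `d − 1` plaquettes of `Λ_L`. [folklore] -/
private theorem card_slot2_le {L : ℕ} (e : ZdEdge d) :
    #((procaPlaquettes d L).filter fun p : ZdPlaquette d =>
        ((p.1 + Pi.single p.2.1.1 1, p.2.1.2) : ZdEdge d) = e) ≤ d - 1 := by
  classical
  have h := Finset.card_le_card_of_injOn (s := (procaPlaquettes d L).filter fun p : ZdPlaquette d =>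
      ((p.1 + Pi.single p.2.1.1 1, p.2.1.2) : ZdEdge d) = e) (t := (Finset.univ : Finset (Fin d)).erase e.2)
    (f := fun p => p.2.1.1) (fun p hp => ?_) (fun p hp p' hp' hpp => ?_)
  · simpa [Finset.card_erase_of_mem (Finset.mem_univ _), Finset.card_univ, Fintype.card_fin] using h
  · obtain ⟨-, hp⟩ := Finset.mem_filter.1 (Finset.mem_coe.1 hp)
    have hj : p.2.1.2 = e.2 := (Prod.mk.inj hp).2
    rw [Finset.mem_coe, Finset.mem_erase]
    exact ⟨fun hi => absurd p.2.2 (by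
      have hi' : p.2.1.1 = e.2 := hi
      rw [hi', hj]; exact lt_irrefl _), Finset.mem_univ _⟩
  · obtain ⟨-, hp1⟩ := Finset.mem_filter.1 (Finset.mem_coe.1 hp)
    obtain ⟨-, hp1'⟩ := Finset.mem_filter.1 (Finset.mem_coe.1 hp')
    obtain ⟨hx, hj⟩ := Prod.mk.inj hp1
    obtain ⟨hx', hj'⟩ := Prod.mk.inj hp1'
    have hii : p.2.1.1 = p'.2.1.1 := hpp
    have hxx : p.1 = p'.1 := by
      have := hx.trans hx'.symm
      rwa [hii, add_left_inj] at this
    exact Prod.ext hxx (Subtype.ext (Prod.ext hii (hj.trans hj'.symm)))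

/-- Fibres of the slot `p ↦ (x + eⱼ, i)`: at most `d − 1` plaquettes of `Λ_L`. [folklore] -/
private theorem card_slot3_le {L : ℕ} (e : ZdEdge d) :
    #((procaPlaquettes d L).filter fun p : ZdPlaquette d =>
        ((p.1 + Pi.single p.2.1.2 1, p.2.1.1) : ZdEdge d) = e) ≤ d - 1 := by
  classical
  have h := Finset.card_le_card_of_injOn (s := (procaPlaquettes d L).filter fun p : ZdPlaquette d =>
      ((p.1 + Pi.single p.2.1.2 1, p.2.1.1) : ZdEdge d) = e) (t := (Finset.univ : Finset (Fin d)).erase e.2)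
    (f := fun p => p.2.1.2) (fun p hp => ?_) (fun p hp p' hp' hpp => ?_)
  · simpa [Finset.card_erase_of_mem (Finset.mem_univ _), Finset.card_univ, Fintype.card_fin] using h
  · obtain ⟨-, hp⟩ := Finset.mem_filter.1 (Finset.mem_coe.1 hp)
    have hi : p.2.1.1 = e.2 := (Prod.mk.inj hp).2
    rw [Finset.mem_coe, Finset.mem_erase]
    exact ⟨fun hj => absurd p.2.2 (by
      have hj' : p.2.1.2 = e.2 := hj
      rw [hi, hj']; exact lt_irrefl _), Finset.mem_univ _⟩
  · obtain ⟨-, hp1⟩ := Finset.mem_filter.1 (Finset.mem_coe.1 hp)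
    obtain ⟨-, hp1'⟩ := Finset.mem_filter.1 (Finset.mem_coe.1 hp')
    obtain ⟨hx, hi⟩ := Prod.mk.inj hp1
    obtain ⟨hx', hi'⟩ := Prod.mk.inj hp1'
    have hjj : p.2.1.2 = p'.2.1.2 := hpp
    have hxx : p.1 = p'.1 := by
      have := hx.trans hx'.symm
      rwa [hjj, add_left_inj] at this
    exact Prod.ext hxx (Subtype.ext (Prod.ext (hi.trans hi'.symm) hjj))

/-- Fibres of the slot `p ↦ (x, j)`: at most `d − 1` plaquettes of `Λ_L`. [folklore] -/
private theorem card_slot4_le {L : ℕ} (e : ZdEdge d) :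
    #((procaPlaquettes d L).filter fun p : ZdPlaquette d => ((p.1, p.2.1.2) : ZdEdge d) = e) ≤ d - 1 := by
  classical
  have h := Finset.card_le_card_of_injOn (s := (procaPlaquettes d L).filter fun p : ZdPlaquette d =>
      ((p.1, p.2.1.2) : ZdEdge d) = e) (t := (Finset.univ : Finset (Fin d)).erase e.2)
    (f := fun p => p.2.1.1) (fun p hp => ?_) (fun p hp p' hp' hpp => ?_)
  · simpa [Finset.card_erase_of_mem (Finset.mem_univ _), Finset.card_univ, Fintype.card_fin] using h
  · obtain ⟨-, hp⟩ := Finset.mem_filter.1 (Finset.mem_coe.1 hp)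
    have hj : p.2.1.2 = e.2 := (Prod.mk.inj hp).2
    rw [Finset.mem_coe, Finset.mem_erase]
    exact ⟨fun hi => absurd p.2.2 (by
      have hi' : p.2.1.1 = e.2 := hi
      rw [hi', hj]; exact lt_irrefl _), Finset.mem_univ _⟩
  · obtain ⟨-, hp1⟩ := Finset.mem_filter.1 (Finset.mem_coe.1 hp)
    obtain ⟨-, hp1'⟩ := Finset.mem_filter.1 (Finset.mem_coe.1 hp')
    obtain ⟨hx, hj⟩ := Prod.mk.inj hp1
    obtain ⟨hx', hj'⟩ := Prod.mk.inj hp1'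
    exact Prod.ext (hx.trans hx'.symm) (Subtype.ext (Prod.ext hpp (hj.trans hj'.symm)))

/-- **Upper form bound**: `vᵀ Q v ≤ (16(d−1) + ε²) ‖v‖²` — `(λ_p·v)² ≤ 4 Σ_{e ∈ p} v(e)²` and each of
the four edge slots of a plaquette is hit by at most `d − 1` plaquettes of `Λ_L` (the printed proof's
bound `Q ≤ 16 d ε^{d−2} I`, at unit lattice spacing). [cite: Chatterjee2026YMHiggs, Lemma 4.10 (proof: "‖Q‖ ≤ 16dε^{d−2}")] -/
theorem dotProduct_precMat_mulVec_le {L : ℕ} (ε : ℝ) (v : procaEdges d L → ℝ) :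
    v ⬝ᵥ precMat d L ε *ᵥ v ≤ (16 * (d - 1 : ℕ) + ε ^ 2) * (v ⬝ᵥ v) := by
  classical
  rw [dotProduct_precMat_mulVec]
  set g : ZdEdge d → ℝ := fun e => extendEdges d L v e ^ 2 with hg
  have hg0 : ∀ e, 0 ≤ g e := fun e => sq_nonneg _
  have hgz : ∀ e, e ∉ procaEdges d L → g e = 0 := fun e he => by
    show extendEdges d L v e ^ 2 = 0
    rw [extendEdges, dif_neg he]; ring
  have hsumg : ∑ e ∈ procaEdges d L, g e = v ⬝ᵥ v := by
    rw [← Finset.sum_coe_sort (procaEdges d L), dotProduct]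
    refine Finset.sum_congr rfl fun f _ => ?_
    show extendEdges d L v f.1 ^ 2 = v f * v f
    rw [extendEdges, dif_pos f.2, sq]
  have hp : ∀ p ∈ procaPlaquettes d L, (curlVec d L p ⬝ᵥ v) ^ 2 ≤
      4 * (g (p.1, p.2.1.1) + g (p.1 + Pi.single p.2.1.1 1, p.2.1.2) +
        g (p.1 + Pi.single p.2.1.2 1, p.2.1.1) + g (p.1, p.2.1.2)) := fun p _ => by
    rw [curlVec_dotProduct, latticeCurl]
    exact sq_add_sub_sub_le _ _ _ _
  have h1 := sum_slot_le (L := L) (fun p : ZdPlaquette d => ((p.1, p.2.1.1) : ZdEdge d)) card_slot1_le g hg0 hgz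
  have h2 := sum_slot_le (L := L) (fun p : ZdPlaquette d => ((p.1 + Pi.single p.2.1.1 1, p.2.1.2) : ZdEdge d))
    card_slot2_le g hg0 hgz
  have h3 := sum_slot_le (L := L) (fun p : ZdPlaquette d => ((p.1 + Pi.single p.2.1.2 1, p.2.1.1) : ZdEdge d))
    card_slot3_le g hg0 hgz
  have h4 := sum_slot_le (L := L) (fun p : ZdPlaquette d => ((p.1, p.2.1.2) : ZdEdge d)) card_slot4_le g hg0 hgz
  rw [hsumg] at h1 h2 h3 h4
  calc ∑ p ∈ procaPlaquettes d L, (curlVec d L p ⬝ᵥ v) ^ 2 + ε ^ 2 * (v ⬝ᵥ v)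
      ≤ ∑ p ∈ procaPlaquettes d L, 4 * (g (p.1, p.2.1.1) + g (p.1 + Pi.single p.2.1.1 1, p.2.1.2) +
          g (p.1 + Pi.single p.2.1.2 1, p.2.1.1) + g (p.1, p.2.1.2)) + ε ^ 2 * (v ⬝ᵥ v) :=
        add_le_add (Finset.sum_le_sum hp) le_rfl
    _ = 4 * (∑ p ∈ procaPlaquettes d L, g (p.1, p.2.1.1) +
          ∑ p ∈ procaPlaquettes d L, g (p.1 + Pi.single p.2.1.1 1, p.2.1.2) +
          ∑ p ∈ procaPlaquettes d L, g (p.1 + Pi.single p.2.1.2 1, p.2.1.1) +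
          ∑ p ∈ procaPlaquettes d L, g (p.1, p.2.1.2)) + ε ^ 2 * (v ⬝ᵥ v) := by
        rw [← Finset.mul_sum, Finset.sum_add_distrib, Finset.sum_add_distrib, Finset.sum_add_distrib]
    _ ≤ 4 * ((d - 1 : ℕ) * (v ⬝ᵥ v) + (d - 1 : ℕ) * (v ⬝ᵥ v) + (d - 1 : ℕ) * (v ⬝ᵥ v) + (d - 1 : ℕ) * (v ⬝ᵥ v)) +
          ε ^ 2 * (v ⬝ᵥ v) := by gcongr
    _ = (16 * (d - 1 : ℕ) + ε ^ 2) * (v ⬝ᵥ v) := by ring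

end Precision

/-! ## §3 The iteration matrix `S = 1 − (16d)⁻¹ Q` -/

section Iteration

variable {d : ℕ}

variable (d) in
/-- The iteration matrix `S = I − (16 d)⁻¹ Q` of the Neumann series for `R = Q⁻¹` (printed:
`S = I − (16 d ε^{d−2})⁻¹ Q` at lattice spacing `ε`). [cite: Chatterjee2026YMHiggs, Lemma 4.10 (proof, definition of S)] -/
def iterMat (L : ℕ) (ε : ℝ) : Matrix (procaEdges d L) (procaEdges d L) ℝ :=
  1 - (16 * (d : ℝ))⁻¹ • precMat d L ε

/-- `S` is symmetric. [folklore] -/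
private theorem iterMat_transpose (L : ℕ) (ε : ℝ) : (iterMat d L ε)ᵀ = iterMat d L ε := by
  rw [iterMat, Matrix.transpose_sub, Matrix.transpose_one, Matrix.transpose_smul, precMat_transpose]

/-- The quadratic form of `S`: `vᵀ S v = ‖v‖² − (16d)⁻¹ vᵀ Q v`. [folklore] -/
private theorem dotProduct_iterMat_mulVec {L : ℕ} (ε : ℝ) (v : procaEdges d L → ℝ) :
    v ⬝ᵥ iterMat d L ε *ᵥ v = v ⬝ᵥ v - (16 * (d : ℝ))⁻¹ * (v ⬝ᵥ precMat d L ε *ᵥ v) := by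
  rw [iterMat, Matrix.sub_mulVec, Matrix.one_mulVec, dotProduct_sub, Matrix.smul_mulVec, dotProduct_smul,
    smul_eq_mul]

/-- **`S ≥ 0`** as a form, for `1 ≤ d` and `ε² ≤ 1` (from `Q ≤ (16(d−1) + ε²) I ≤ 16 d I`).
[cite: Chatterjee2026YMHiggs, Lemma 4.10 (proof, "0 ≤ S")] -/
theorem dotProduct_iterMat_mulVec_nonneg {L : ℕ} (hd : 1 ≤ d) {ε : ℝ} (hε : ε ^ 2 ≤ 1)
    (v : procaEdges d L → ℝ) : 0 ≤ v ⬝ᵥ iterMat d L ε *ᵥ v := by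
  rw [dotProduct_iterMat_mulVec]
  have h1 := dotProduct_precMat_mulVec_le ε v
  have hvv := dotProduct_self_nonneg' v
  have hd' : (16 : ℝ) * (d - 1 : ℕ) + ε ^ 2 ≤ 16 * d := by
    rw [Nat.cast_sub hd, Nat.cast_one]; linarith
  have hd0 : (0 : ℝ) < 16 * d := by
    have : (1 : ℝ) ≤ d := by exact_mod_cast hd
    linarith
  have h2 : v ⬝ᵥ precMat d L ε *ᵥ v ≤ 16 * d * (v ⬝ᵥ v) := h1.trans (mul_le_mul_of_nonneg_right hd' hvv)
  rw [sub_nonneg, inv_mul_le_iff₀ hd0]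
  linarith

/-- **`S ≤ 1 − ε²/(16d)`** as a form (from `Q ≥ ε² I`). [cite: Chatterjee2026YMHiggs, Lemma 4.10 (proof, "‖S‖ ≤ 1 − ε²/(16d)")] -/
theorem dotProduct_iterMat_mulVec_le {L : ℕ} (hd : 1 ≤ d) (ε : ℝ) (v : procaEdges d L → ℝ) :
    v ⬝ᵥ iterMat d L ε *ᵥ v ≤ (1 - ε ^ 2 / (16 * d)) * (v ⬝ᵥ v) := by
  rw [dotProduct_iterMat_mulVec]
  have h1 := le_dotProduct_precMat_mulVec ε v
  have hd0 : (0 : ℝ) < 16 * d := by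
    have : (1 : ℝ) ≤ d := by exact_mod_cast hd
    linarith
  have h2 : (16 * (d : ℝ))⁻¹ * (ε ^ 2 * (v ⬝ᵥ v)) ≤ (16 * (d : ℝ))⁻¹ * (v ⬝ᵥ precMat d L ε *ᵥ v) :=
    mul_le_mul_of_nonneg_left h1 (inv_nonneg.2 hd0.le)
  have h3 : (1 - ε ^ 2 / (16 * d)) * (v ⬝ᵥ v) = v ⬝ᵥ v - (16 * (d : ℝ))⁻¹ * (ε ^ 2 * (v ⬝ᵥ v)) := by
    ring
  rw [h3]
  linarith

/-- An entry of `λ_p` is non-zero only on the edges of `p`. [folklore] -/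
private theorem mem_plaquetteEdges_of_curlVec_ne_zero {L : ℕ} {p : ZdPlaquette d} {f : procaEdges d L}
    (h : curlVec d L p f ≠ 0) : f.1 ∈ plaquetteEdges p := by
  classical
  by_contra hne
  simp only [plaquetteEdges, Finset.mem_insert, Finset.mem_singleton, not_or] at hne
  obtain ⟨h1, h2, h3, h4⟩ := hne
  simp [curlVec, h1, h2, h3, h4] at h

/-- **Support of `S`**: an off-diagonal entry `S(f, f')` is non-zero only if `f, f'` share a plaquette of
`Λ_L`, i.e. are adjacent in `procaEdgeGraph`. [cite: Chatterjee2026YMHiggs, Lemma 4.10 (proof, "S(e,e') = 0 unless e, e' are neighbors or equal")] -/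
theorem iterMat_apply_ne_zero {L : ℕ} (ε : ℝ) (f f' : procaEdges d L) (h : iterMat d L ε f f' ≠ 0) :
    f.1 = f'.1 ∨ (procaEdgeGraph d L).Adj f.1 f'.1 := by
  classical
  by_cases hff : f = f'
  · exact Or.inl (congrArg Subtype.val hff)
  · right
    have hne : f.1 ≠ f'.1 := fun h' => hff (Subtype.ext h')
    have h1 : (∑ p ∈ procaPlaquettes d L, vecMulVec (curlVec d L p) (curlVec d L p)) f f' ≠ 0 := by
      intro h0
      apply h
      rw [iterMat, Matrix.sub_apply, Matrix.one_apply_ne hff, Matrix.smul_apply, precMat, Matrix.add_apply, h0,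
        Matrix.smul_apply, Matrix.one_apply_ne hff, smul_zero, add_zero, smul_zero, sub_zero]
    rw [Matrix.sum_apply] at h1
    obtain ⟨p, hp, hp'⟩ := Finset.exists_ne_zero_of_sum_ne_zero h1
    rw [vecMulVec_apply] at hp'
    have ha : curlVec d L p f ≠ 0 := fun h0 => hp' (by rw [h0, zero_mul])
    have hb : curlVec d L p f' ≠ 0 := fun h0 => hp' (by rw [h0, mul_zero])
    rw [procaEdgeGraph, SimpleGraph.fromRel_adj]
    exact ⟨hne, Or.inl ⟨p, hp, mem_plaquetteEdges_of_curlVec_ne_zero ha,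
      mem_plaquetteEdges_of_curlVec_ne_zero hb⟩⟩

/-- `Sʲ(f, f') ≠ 0 ⇒ d(f, f') ≤ j` in `procaEdgeGraph`. [cite: Chatterjee2026YMHiggs, Lemma 4.10 (proof, "Sᵏ(e,e') = 0 whenever k < d(e,e')")] -/
theorem edist_le_of_iterMat_pow_ne_zero {L : ℕ} (ε : ℝ) (j : ℕ) (f f' : procaEdges d L)
    (h : (iterMat d L ε ^ j) f f' ≠ 0) : (procaEdgeGraph d L).edist f.1 f'.1 ≤ j := by
  classical
  exact edist_le_of_pow_apply_ne_zero (procaEdgeGraph d L) (fun f : procaEdges d L => f.1)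
    (fun i i' hi => iterMat_apply_ne_zero ε i i' hi) j f f' h

end Iteration

/-! ## §4 The discrete Proca measure is the centred Gaussian with covariance `Q⁻¹` -/

section Gaussian

variable {d : ℕ}

/-- Extension by zero is measurable. [folklore] -/
private theorem measurable_extendEdges (L : ℕ) : Measurable (extendEdges d L) := by
  refine measurable_pi_lambda _ fun e => ?_
  by_cases he : e ∈ procaEdges d L
  · have h1 : (fun y : procaEdges d L → ℝ => extendEdges d L y e) = fun y => y ⟨e, he⟩ := by
      funext y; exact dif_pos he
    rw [h1]; exact measurable_pi_apply _
  · have h1 : (fun y : procaEdges d L → ℝ => extendEdges d L y e) = fun _ => 0 := by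
      funext y; exact dif_neg he
    rw [h1]; exact measurable_const

/-- **The Proca weight is the Gaussian weight of `Q`**, transported along the volume-preserving
identification `EuclideanSpace ℝ E ≃ (E → ℝ)`: `e^{−H(x)} dx = (e^{−½ xᵀQx} dx) ∘ ofLp⁻¹`.
[cite: Chatterjee2026YMHiggs, Def. 4.5 and Lemma 4.10 (proof, "density proportional to exp(−½xᵀQx)")] -/
theorem procaWeight_eq_map (L : ℕ) (ε : ℝ) :
    procaWeight d L ε = ((volume : Measure (EuclideanSpace ℝ (procaEdges d L))).withDensity
      (gaussWeight (precMat d L ε))).map ofLp := by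
  classical
  have h := map_withDensity_equiv (MeasurableEquiv.toLp 2 (procaEdges d L → ℝ)).symm
    (volume : Measure (EuclideanSpace ℝ (procaEdges d L))) (gaussWeight (precMat d L ε))
  rw [MeasurableEquiv.coe_toLp_symm, MeasurableEquiv.symm_symm,
    (PiLp.volume_preserving_ofLp (procaEdges d L)).map_eq] at h
  rw [h, procaWeight]
  congr 1
  funext y
  rw [Function.comp_apply, MeasurableEquiv.coe_toLp, gaussWeight, WithLp.ofLp_toLp,
    dotProduct_precMat_mulVec_eq_procaEnergy]
  congr 2
  ring

/-- The total mass of the Proca weight is the Gaussian integral `Z_Q`. [folklore] -/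
private theorem procaWeight_univ (L : ℕ) (ε : ℝ) : procaWeight d L ε Set.univ = gaussZ (precMat d L ε) := by
  rw [procaWeight_eq_map, Measure.map_apply (WithLp.measurable_ofLp 2 _) MeasurableSet.univ, Set.preimage_univ,
    withDensity_apply _ MeasurableSet.univ, Measure.restrict_univ, gaussZ]

/-- **Definition 4.5 as a Gaussian law**: for `ε ≠ 0` the discrete Proca measure is the image, under
extension by zero, of the centred multivariate Gaussian on `ℝ^{E}` with covariance matrix `Q⁻¹`
("`X` is a centred Gaussian vector with covariance `R = Q⁻¹`").
[cite: Chatterjee2026YMHiggs, Def. 4.5 and Lemma 4.10 (proof, "Cov(X) = R = Q⁻¹")] -/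
theorem discreteProcaMeasure_eq_map (L : ℕ) {ε : ℝ} (hε : ε ≠ 0) :
    discreteProcaMeasure d L ε =
      (multivariateGaussian 0 (precMat d L ε)⁻¹).map (extendEdges d L ∘ ofLp) := by
  classical
  obtain ⟨hG, -, -⟩ := multivariateGaussian_inv_eq_withDensity (posDef_precMat (d := d) L hε)
  rw [discreteProcaMeasure, procaWeight_univ, procaWeight_eq_map, ← Measure.map_smul, ← hG,
    Measure.map_map (measurable_extendEdges L) (WithLp.measurable_ofLp 2 _)]

/-- The coordinates of the centred multivariate Gaussian are centred. [folklore] -/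
private theorem integral_eval_multivariateGaussian_zero {ι : Type*} [Fintype ι] [DecidableEq ι]
    {S : Matrix ι ι ℝ} (hS : S.PosSemidef) (i : ι) :
    ∫ x, x i ∂(multivariateGaussian 0 S) = 0 := by
  have hmp := measurePreserving_eval_multivariateGaussian (μ := 0) hS (i := i)
  have h1 : ∫ t, t ∂((multivariateGaussian 0 S).map fun x => x i) = ∫ x, x i ∂(multivariateGaussian 0 S) :=
    integral_map hmp.measurable.aemeasurable measurable_id'.aestronglyMeasurable
  rw [← h1, hmp.map_eq, integral_id_gaussianReal]
  rfl

/-- **`E(X(e) X(e')) = Q⁻¹(e, e')`** for edges `e, e'` of `Λ_L` (`ε ≠ 0`): the discrete Proca field is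
centred Gaussian with covariance `R = Q⁻¹`. [cite: Chatterjee2026YMHiggs, Lemma 4.10 (proof, "E(X(e)X(e')) = R(e,e')")] -/
theorem integral_mul_discreteProcaMeasure (L : ℕ) {ε : ℝ} (hε : ε ≠ 0) {e e' : ZdEdge d}
    (he : e ∈ procaEdges d L) (he' : e' ∈ procaEdges d L) :
    ∫ x, x e * x e' ∂(discreteProcaMeasure d L ε) = (precMat d L ε)⁻¹ ⟨e, he⟩ ⟨e', he'⟩ := by
  classical
  have hS : ((precMat d L ε)⁻¹).PosSemidef := (posDef_precMat (d := d) L hε).inv.posSemidef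
  have hf : Measurable fun x : ZdEdge d → ℝ => x e * x e' := (measurable_pi_apply e).mul (measurable_pi_apply e')
  rw [discreteProcaMeasure_eq_map L hε,
    integral_map ((measurable_extendEdges L).comp (WithLp.measurable_ofLp 2 _)).aemeasurable hf.aestronglyMeasurable]
  have h1 : ∀ z : EuclideanSpace ℝ (procaEdges d L),
      (extendEdges d L ∘ ofLp) z e * (extendEdges d L ∘ ofLp) z e' = z ⟨e, he⟩ * z ⟨e', he'⟩ := by
    intro z
    simp only [Function.comp_apply, extendEdges, dif_pos he, dif_pos he']
  simp_rw [h1]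
  have hcov := covariance_eval_multivariateGaussian (μ := 0) hS ⟨e, he⟩ ⟨e', he'⟩
  rw [covariance] at hcov
  simpa only [integral_eval_multivariateGaussian_zero hS, sub_zero] using hcov

end Gaussian

/-! ## §5 Assembly: `|Q⁻¹(e, e')| ≤ ε⁻² (1 − ε²/(16d))^{d(e,e')}` and the theorem -/

section Assembly

variable {d : ℕ}

/-- `‖v‖² = v·v` for the Euclidean norm of `toLp 2 v`. [folklore] -/
private theorem norm_toLp_sq_eq_dotProduct {ι : Type*} [Fintype ι] (v : ι → ℝ) :
    ‖(WithLp.toLp 2 v : EuclideanSpace ℝ ι)‖ ^ 2 = v ⬝ᵥ v := by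
  rw [EuclideanSpace.real_norm_sq_eq, dotProduct]
  exact Finset.sum_congr rfl fun i _ => by rw [WithLp.ofLp_toLp, sq]

/-- **The entry bound for `R = Q⁻¹`** (the heart of Lemma 4.10): for `1 ≤ d`, `0 < ε ≤ 1`, edges
`f, f'` of `Λ_L` and every `k ≤ d(f, f')`, `|Q⁻¹(f, f')| ≤ ε⁻² (1 − ε²/(16d))ᵏ`.  Proof:
`Q⁻¹ = SᵏQ⁻¹ + M⁻¹Σ_{j<k}Sʲ` with `Sʲ(f,f') = 0` for `j < k`, and
`|(SᵏQ⁻¹)(f,f')| = |δ_fᵀ Sᵏ (Q⁻¹δ_{f'})| ≤ θᵏ ‖Q⁻¹ δ_{f'}‖ ≤ θᵏ ε⁻²`.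
[cite: Chatterjee2026YMHiggs, Lemma 4.10 (proof)] -/
theorem abs_precMat_inv_apply_le {L : ℕ} (hd : 1 ≤ d) {ε : ℝ} (hε : 0 < ε) (hε1 : ε ≤ 1)
    (f f' : procaEdges d L) (k : ℕ) (hk : (k : ℕ∞) ≤ (procaEdgeGraph d L).edist f.1 f'.1) :
    |(precMat d L ε)⁻¹ f f'| ≤ (ε ^ 2)⁻¹ * (1 - ε ^ 2 / (16 * d)) ^ k := by
  classical
  set Q := precMat d L ε with hQ
  set θ : ℝ := 1 - ε ^ 2 / (16 * d) with hθ
  have hQpd : Q.PosDef := posDef_precMat (d := d) L hε.ne'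
  have hQdet : IsUnit Q.det := (Matrix.isUnit_iff_isUnit_det _).1 hQpd.isUnit
  have hε2 : ε ^ 2 ≤ 1 := by nlinarith
  have hd0 : (0 : ℝ) < 16 * d := by
    have : (1 : ℝ) ≤ d := by exact_mod_cast hd
    linarith
  have hθ0 : 0 ≤ θ := by
    rw [hθ, sub_nonneg, div_le_one hd0]
    have : (1 : ℝ) ≤ d := by exact_mod_cast hd
    nlinarith
  -- the iteration matrix and its form bounds
  have hSt : (iterMat d L ε)ᵀ = iterMat d L ε := iterMat_transpose L ε
  have hS0 : ∀ v, 0 ≤ v ⬝ᵥ iterMat d L ε *ᵥ v := dotProduct_iterMat_mulVec_nonneg hd hε2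
  have hSup : ∀ v, v ⬝ᵥ iterMat d L ε *ᵥ v ≤ θ * (v ⬝ᵥ v) := dotProduct_iterMat_mulVec_le hd ε
  -- Neumann identity, entry `(f, f')`: the partial sums vanish below the graph distance
  have hN := inv_eq_pow_mul_inv_add_sum hQdet (16 * (d : ℝ)) k
  have hsum0 : (∑ j ∈ Finset.range k, iterMat d L ε ^ j) f f' = 0 := by
    rw [Matrix.sum_apply]
    refine Finset.sum_eq_zero fun j hj => ?_
    by_contra hne
    have h1 := edist_le_of_iterMat_pow_ne_zero ε j f f' hne
    have hjk : j < k := Finset.mem_range.1 hj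
    have h2 : ((k : ℕ) : ℕ∞) ≤ (j : ℕ∞) := hk.trans h1
    exact absurd (by exact_mod_cast h2) (not_le.2 hjk)
  have hentry : Q⁻¹ f f' = (iterMat d L ε ^ k * Q⁻¹) f f' := by
    have h1 := congrFun (congrFun hN f) f'
    rw [Matrix.add_apply, Matrix.smul_apply] at h1
    change Q⁻¹ f f' = (iterMat d L ε ^ k * Q⁻¹) f f' +
      (16 * (d : ℝ))⁻¹ • (∑ j ∈ Finset.range k, iterMat d L ε ^ j) f f' at h1
    rw [hsum0, smul_zero, add_zero] at h1
    exact h1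
  -- `(Sᵏ Q⁻¹)(f, f') = δ_f · Sᵏ (Q⁻¹ δ_{f'})`
  set w : procaEdges d L → ℝ := Q⁻¹ *ᵥ Pi.single f' 1 with hw
  have hrepr : (iterMat d L ε ^ k * Q⁻¹) f f' = Pi.single f 1 ⬝ᵥ (iterMat d L ε ^ k *ᵥ w) := by
    rw [hw, Matrix.mulVec_mulVec, Matrix.mulVec_single_one, single_one_dotProduct, Matrix.col_apply]
  -- the bound
  have hcs := dotProduct_pow_mulVec_sq_le hSt hS0 hθ0 hSup k (Pi.single f 1) w
  have hu : (Pi.single f (1 : ℝ)) ⬝ᵥ Pi.single f 1 = 1 := by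
    rw [single_one_dotProduct, Pi.single_eq_same]
  have hww : w ⬝ᵥ w ≤ ((ε ^ 2)⁻¹) ^ 2 := by
    have hlow : ∀ v : procaEdges d L → ℝ,
        ε ^ 2 * ‖(WithLp.toLp 2 v : EuclideanSpace ℝ (procaEdges d L))‖ ^ 2 ≤ v ⬝ᵥ Q *ᵥ v := fun v => by
      rw [norm_toLp_sq_eq_dotProduct]; exact le_dotProduct_precMat_mulVec ε v
    have h1 := norm_inv_mulVec_le hQpd (pow_pos hε 2) hlow (Pi.single f' 1)
    rw [norm_toLp_single, ← hw] at h1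
    rw [← norm_toLp_sq_eq_dotProduct, one_div] at *
    have h0 : 0 ≤ ‖(WithLp.toLp 2 w : EuclideanSpace ℝ (procaEdges d L))‖ := norm_nonneg _
    nlinarith
  have hsq : (Pi.single f 1 ⬝ᵥ (iterMat d L ε ^ k *ᵥ w)) ^ 2 ≤ ((ε ^ 2)⁻¹ * θ ^ k) ^ 2 := by
    rw [hu, mul_one] at hcs
    calc (Pi.single f 1 ⬝ᵥ (iterMat d L ε ^ k *ᵥ w)) ^ 2 ≤ θ ^ (2 * k) * (w ⬝ᵥ w) := hcs
      _ ≤ θ ^ (2 * k) * ((ε ^ 2)⁻¹) ^ 2 := mul_le_mul_of_nonneg_left hww (pow_nonneg hθ0 _)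
      _ = ((ε ^ 2)⁻¹ * θ ^ k) ^ 2 := by ring
  rw [hentry, hrepr]
  exact abs_le_of_sq_le_sq hsq (by positivity)

end Assembly

end CovarianceDecayProof

open CovarianceDecayProof in
/-- **Chatterjee 2026, Lemma 4.10 (covariance decay of the discrete Proca field) — the named fact
`discreteProca_covariance_decay` PROVED.** For `2 ≤ d`, `0 < ε ≤ 1`, edges `e, e'` of
`Λ_L = {−L, …, L}ᵈ` and every `k ≤ d(e, e')` (graph distance in the plaquette-neighbour graph),
`|∫ x(e) x(e') dX| ≤ ε⁻² (1 − ε²/(16 d))ᵏ` under the discrete Proca law of Definition 4.5.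
Proof as printed (§4.6): `E(X(e)X(e')) = Q⁻¹(e,e')` (`integral_mul_discreteProcaMeasure`),
`Q = 16d(I − S)` with `0 ≤ S ≤ 1 − ε²/(16d)` and `Sʲ(e,e') = 0` for `j < d(e,e')`, Neumann series
(`abs_precMat_inv_apply_le`). [cite: Chatterjee2026YMHiggs, Lemma 4.10 (§4.6); proof ibid.] -/
theorem discreteProca_covariance_decay_holds : discreteProca_covariance_decay := by
  intro d L ε hd hε hε1 e he e' he' k hk
  rw [integral_mul_discreteProcaMeasure L hε.ne' he he']
  exact abs_precMat_inv_apply_le (by omega) hε hε1 ⟨e, he⟩ ⟨e', he'⟩ k hk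


end Literature.MathematicalPhysics.QuantumFieldTheory.Chatterjee2026YMHiggs

end
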